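import Summits.PneNP.PneNP.Theorems.ExpanderLinearGeneratorsMooreTree

/-!
# A Moore-type bound for `(r, 6)`-boundary expanders with `8`-point scopes, IV: the collision
configurations (route ExpanderLinearGenerators, item stmt-PneNP-11442, helper file)

PHASE TWO of the Moore argument grows the exploration tree (file II) from a row `ρ []` lying on a
cycle `Z` of the incidence graph (from phase one, file III), leaving the root only through points
off `Z` (`H6`). This file shows that every COLLISION of that tree — a new entry point or row
coinciding with a processed one, with another new one, or with a vertex of `Z` — produces a
configuration forbidden by the configuration lemma of file I (`config_contra`): the cycle `Z`,
the tree paths to the colliding nodes and the one to four fresh edges of the collision form a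
subgraph with all degrees `≥ 2`, degree `≥ 3` at the root, and at most `|Z| + 4n + 10` vertices.
The three POINT collisions are here (`collision_pointZ`, `collision_point_old`,
`collision_point_new`); the three ROW collisions (`collision_rowZ`, `collision_row_old`,
`collision_row_new`) are in the next file.
-/

namespace Summit.PneNP.PneNP.Theorems

set_option linter.dupNamespace false -- `Summit.PneNP.PneNP.…`: summit = sub-problem (D-0017)

namespace MooreBound

open Finset SimpleGraph Literature.Computability.MetaComplexity

variable {ι : Type*} {S : ι → Finset ℕ} {F : Finset ι} {G : SimpleGraph (ι ⊕ ℕ)}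

section PhaseTwo

variable (hG : ∀ x y, G.Adj x y ↔ ∃ a v, a ∈ F ∧ v ∈ S a ∧
  ((x = Sum.inl a ∧ y = Sum.inr v) ∨ (x = Sum.inr v ∧ y = Sum.inl a)))
variable {ρ : List Bool → ι} {φ : List Bool → ℕ}
variable (H1 : ∀ w, ρ w ∈ F)
variable (H2 : ∀ c w, φ (c :: w) ∈ S (ρ w) ∧ φ (c :: w) ∈ S (ρ (c :: w)))
variable (H5 : ∀ c c' w, φ (c :: c' :: w) ≠ φ (c' :: w))
variable {Z : G.Walk (Sum.inl (ρ [])) (Sum.inl (ρ []))} (hZ : Z.IsCycle)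
variable (H6 : ∀ c, Sum.inr (φ [c]) ≠ Z.snd ∧ Sum.inr (φ [c]) ≠ Z.penultimate)

include hG

/-! #### Degree bookkeeping -/

include hZ H6 in
/-- The root has `C`-degree `≥ 3` as soon as `C` contains `Z` and the tree path to a non-root node
(its second vertex is the entry point of a child of the root, off `Z` by `H6`). [folklore] -/
theorem three_le_of_treePath {C : G.Subgraph} (hZC : Z.toSubgraph ≤ C) {n : ℕ}
    (hIR : ∀ u u' : List Bool, u.length ≤ n → u'.length ≤ n → ρ u = ρ u' → u = u')
    {w : List Bool} (hw : w.length ≤ n) (hwne : w ≠ [])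
    {P : G.Walk (Sum.inl (ρ [])) (Sum.inl (ρ w))}
    (hedges : ∀ e ∈ P.edges, ∃ (c : Bool) (u : List Bool), (c :: u) <:+ w ∧
      (e = s(Sum.inl (ρ u), Sum.inr (φ (c :: u))) ∨
        e = s(Sum.inr (φ (c :: u)), Sum.inl (ρ (c :: u)))))
    (hPC : P.toSubgraph ≤ C) : 3 ≤ (C.neighborSet (Sum.inl (ρ []))).ncard := by
  obtain ⟨c, hc⟩ := treePath_snd (ρ := ρ) (φ := φ) hIR hw hwne hedges
  have hnil : ¬ P.Nil := Walk.not_nil_of_ne fun h =>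
    hwne (hIR w [] hw (by simp) (Sum.inl_injective h).symm)
  refine three_le_ncard_neighborSet hG (hZC.2 (Z.toSubgraph_adj_snd hZ.not_nil))
    (hZC.2 (Z.toSubgraph_adj_penultimate hZ.not_nil)).symm (hPC.2 (P.toSubgraph_adj_snd hnil))
    hZ.snd_ne_penultimate ?_ ?_
  · rw [hc]; exact (H6 c).1.symm
  · rw [hc]; exact (H6 c).2.symm

include hZ in
/-- The root has `C`-degree `≥ 3` as soon as `C` contains `Z` and an edge from the root to a
vertex off `Z`. [folklore] -/
theorem three_le_of_adj_notMem {C : G.Subgraph} (hZC : Z.toSubgraph ≤ C) {t : ι ⊕ ℕ}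
    (ht : C.Adj (Sum.inl (ρ [])) t) (htZ : t ∉ Z.support) :
    3 ≤ (C.neighborSet (Sum.inl (ρ []))).ncard := by
  refine three_le_ncard_neighborSet hG (hZC.2 (Z.toSubgraph_adj_snd hZ.not_nil))
    (hZC.2 (Z.toSubgraph_adj_penultimate hZ.not_nil)).symm ht hZ.snd_ne_penultimate ?_ ?_
  · rintro rfl; exact htZ (Z.getVert_mem_support 1)
  · rintro rfl; exact htZ (Z.getVert_mem_support _)

include hZ in
/-- A vertex of the tree path to `w` has `C`-degree `≥ 2` when `C` contains `Z` and the path,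
provided the end `ρ w` (if `w ≠ []`) has a `C`-neighbour other than its entry point. [folklore] -/
theorem two_le_of_mem_treePath {C : G.Subgraph} (hZC : Z.toSubgraph ≤ C) {n : ℕ}
    (hIR : ∀ u u' : List Bool, u.length ≤ n → u'.length ≤ n → ρ u = ρ u' → u = u')
    {w : List Bool} (hw : w.length ≤ n) {P : G.Walk (Sum.inl (ρ [])) (Sum.inl (ρ w))}
    (hP : P.IsPath)
    (hedges : ∀ e ∈ P.edges, ∃ (c : Bool) (u : List Bool), (c :: u) <:+ w ∧
      (e = s(Sum.inl (ρ u), Sum.inr (φ (c :: u))) ∨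
        e = s(Sum.inr (φ (c :: u)), Sum.inl (ρ (c :: u)))))
    (hPC : P.toSubgraph ≤ C)
    (hend : w ≠ [] → ∃ t, C.Adj (Sum.inl (ρ w)) t ∧ t ≠ Sum.inr (φ w))
    {x : ι ⊕ ℕ} (hx : x ∈ P.support) : 2 ≤ (C.neighborSet x).ncard := by
  by_cases hx0 : x = Sum.inl (ρ [])
  · subst hx0
    exact two_le_ncard_of_cycle hG hZ hZC Z.start_mem_support
  by_cases hx1 : x = Sum.inl (ρ w)
  · subst hx1
    have hwne : w ≠ [] := by rintro rfl; exact hx0 rfl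
    obtain ⟨t, ht, htw⟩ := hend hwne
    have hnil : ¬ P.Nil := Walk.not_nil_of_ne fun h => hx0 h.symm
    have hpen := treePath_penultimate (ρ := ρ) (φ := φ) hIR hw hwne hedges
    have hadj : C.Adj (Sum.inl (ρ w)) (Sum.inr (φ w)) := by
      rw [← hpen]; exact (hPC.2 (P.toSubgraph_adj_penultimate hnil)).symm
    exact two_le_ncard_neighborSet hG ht hadj htw
  · exact two_le_ncard_of_path_internal hG hP hPC hx hx0 hx1

omit hG in
/-- Vertices of `C` all lie on a list of length `≤ r`: the form in which `config_contra` takes its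
size hypothesis, prepared for a union of `Z`, two walks and a list of extra vertices. [folklore] -/
theorem length_bound_aux {r : ℝ} (P₁ P₂ X : List (ι ⊕ ℕ)) {n : ℕ}
    (h₁ : P₁.length ≤ 2 * n + 1) (h₂ : P₂.length ≤ 2 * n + 1) (hX : X.length ≤ 7)
    (hr : ((Z.length + 4 * n + 10 : ℕ) : ℝ) ≤ r) :
    ((Z.support ++ P₁ ++ P₂ ++ X).length : ℝ) ≤ r := by
  have h : (Z.support ++ P₁ ++ P₂ ++ X).length ≤ Z.length + 4 * n + 10 := by
    simp only [List.length_append, Walk.length_support]; omega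
  exact le_trans (by exact_mod_cast h) hr

variable [DecidableEq ι]
variable (hS8 : ∀ a ∈ F, (S a).card ≤ 8) {r : ℝ} (hexp : IsBoundaryExpander S r 6)

include H1 H2 H5 hZ H6 hS8 hexp

/-! #### The six collisions -/

/-- **A new entry point on `Z`.** [folklore] -/
theorem collision_pointZ {n : ℕ} (hr : ((Z.length + 4 * n + 10 : ℕ) : ℝ) ≤ r)
    (hIR : ∀ u u' : List Bool, u.length ≤ n → u'.length ≤ n → ρ u = ρ u' → u = u')
    {w : List Bool} (hw : w.length ≤ n) (c : Bool)
    (hyZ : (Sum.inr (φ (c :: w)) : ι ⊕ ℕ) ∈ Z.support) : False := by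
  obtain ⟨P, hP, -, hPe, hPl⟩ := exists_treePath hG H1 H2 (ρ := ρ) (φ := φ) w
  have hne5 : ∀ (c₀ : Bool) {u : List Bool}, u ≠ [] → φ (c₀ :: u) ≠ φ u := fun c₀ u hu => by
    obtain ⟨c', u', rfl⟩ := List.exists_cons_of_ne_nil hu
    exact H5 c₀ c' u'
  have hwy := adj_parent hG H1 H2 c w
  set C := Z.toSubgraph ⊔ P.toSubgraph ⊔ G.subgraphOfAdj hwy with hC
  have hZC : Z.toSubgraph ≤ C := le_sup_left.trans le_sup_left
  have hPC : P.toSubgraph ≤ C := le_sup_right.trans le_sup_left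
  have hEC : G.subgraphOfAdj hwy ≤ C := le_sup_right
  have hCwy : C.Adj (Sum.inl (ρ w)) (Sum.inr (φ (c :: w))) := hEC.2 (subgraphOfAdj_adj_self hwy)
  refine config_contra hG hS8 hexp C ?_ (b := ρ []) ?_
    (L := Z.support ++ P.support ++ [] ++ [Sum.inl (ρ w), Sum.inr (φ (c :: w))]) ?_
    (length_bound_aux (Z := Z) P.support [] _ (by rw [Walk.length_support]; omega) (by simp)
      (by simp) hr)
  · intro x hx
    simp only [hC, Subgraph.verts_sup, Set.mem_union, Walk.verts_toSubgraph, Set.mem_setOf_eq,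
      subgraphOfAdj_verts, Set.mem_insert_iff, Set.mem_singleton_iff] at hx
    rcases hx with (hx | hx) | rfl | rfl
    · exact two_le_ncard_of_cycle hG hZ hZC hx
    · exact two_le_of_mem_treePath hG hZ hZC hIR hw hP hPe hPC
        (fun hwne => ⟨_, hCwy, fun h => hne5 c hwne (Sum.inr_injective h)⟩) hx
    · exact two_le_of_mem_treePath hG hZ hZC hIR hw hP hPe hPC
        (fun hwne => ⟨_, hCwy, fun h => hne5 c hwne (Sum.inr_injective h)⟩)
        P.end_mem_support
    · exact two_le_ncard_of_cycle hG hZ hZC hyZ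
  · rcases eq_or_ne w [] with rfl | hwne
    · exact three_le_ncard_neighborSet hG (hZC.2 (Z.toSubgraph_adj_snd hZ.not_nil))
        (hZC.2 (Z.toSubgraph_adj_penultimate hZ.not_nil)).symm hCwy hZ.snd_ne_penultimate
        (H6 c).1.symm (H6 c).2.symm
    · exact three_le_of_treePath hG hZ H6 hZC hIR hw hwne hPe hPC
  · intro x hx
    simp only [hC, Subgraph.verts_sup, Set.mem_union, Walk.verts_toSubgraph, Set.mem_setOf_eq,
      subgraphOfAdj_verts, Set.mem_insert_iff, Set.mem_singleton_iff] at hx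
    simp only [List.append_nil, List.mem_append, List.mem_cons, List.not_mem_nil, or_false]
    rcases hx with ((hx | hx) | hx | hx) <;> simp only [hx, true_or, or_true]

/-- **A new entry point equal to a processed one** (`φ (c :: w) = φ (cz :: z')` with
`|z'| < |w| ≤ n`). [folklore] -/
theorem collision_point_old {n : ℕ} (hr : ((Z.length + 4 * n + 10 : ℕ) : ℝ) ≤ r)
    (hIR : ∀ u u' : List Bool, u.length ≤ n → u'.length ≤ n → ρ u = ρ u' → u = u')
    {w z' : List Bool} (hw : w.length ≤ n) (hz' : z'.length ≤ n) (hz'w : z' ≠ w) (hwne : w ≠ [])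
    (c cz : Bool) (heq : φ (c :: w) = φ (cz :: z')) : False := by
  obtain ⟨P, hP, -, hPe, hPl⟩ := exists_treePath hG H1 H2 (ρ := ρ) (φ := φ) w
  have hne5 : ∀ (c₀ : Bool) {u : List Bool}, u ≠ [] → φ (c₀ :: u) ≠ φ u := fun c₀ u hu => by
    obtain ⟨c', u', rfl⟩ := List.exists_cons_of_ne_nil hu
    exact H5 c₀ c' u'
  obtain ⟨Q, hQ, -, hQe, hQl⟩ := exists_treePath hG H1 H2 (ρ := ρ) (φ := φ) z'
  have hwy := adj_parent hG H1 H2 c w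
  have hzy : G.Adj (Sum.inl (ρ z')) (Sum.inr (φ (c :: w))) := by
    rw [heq]; exact adj_parent hG H1 H2 cz z'
  set C := Z.toSubgraph ⊔ P.toSubgraph ⊔ Q.toSubgraph ⊔ G.subgraphOfAdj hwy ⊔
    G.subgraphOfAdj hzy with hC
  have hZC : Z.toSubgraph ≤ C := le_sup_left.trans (le_sup_left.trans (le_sup_left.trans le_sup_left))
  have hPC : P.toSubgraph ≤ C := le_sup_right.trans (le_sup_left.trans (le_sup_left.trans le_sup_left))
  have hQC : Q.toSubgraph ≤ C := le_sup_right.trans (le_sup_left.trans le_sup_left)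
  have hCwy : C.Adj (Sum.inl (ρ w)) (Sum.inr (φ (c :: w))) :=
    (le_sup_right.trans le_sup_left : G.subgraphOfAdj hwy ≤ C).2 (subgraphOfAdj_adj_self hwy)
  have hCzy : C.Adj (Sum.inl (ρ z')) (Sum.inr (φ (c :: w))) :=
    (le_sup_right : G.subgraphOfAdj hzy ≤ C).2 (subgraphOfAdj_adj_self hzy)
  have hendw : w ≠ [] → ∃ t, C.Adj (Sum.inl (ρ w)) t ∧ t ≠ Sum.inr (φ w) :=
    fun hwne => ⟨_, hCwy, fun h => hne5 c hwne (Sum.inr_injective h)⟩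
  have hendz : z' ≠ [] → ∃ t, C.Adj (Sum.inl (ρ z')) t ∧ t ≠ Sum.inr (φ z') :=
    fun hzne => ⟨_, hCzy, fun h => hne5 cz hzne (heq.symm.trans (Sum.inr_injective h))⟩
  have hρ : (Sum.inl (ρ w) : ι ⊕ ℕ) ≠ Sum.inl (ρ z') := fun h =>
    hz'w (hIR _ _ hz' hw (Sum.inl_injective h).symm)
  refine config_contra hG hS8 hexp C ?_ (b := ρ []) (three_le_of_treePath hG hZ H6 hZC hIR hw hwne hPe hPC)
    (L := Z.support ++ P.support ++ Q.support ++
      [Sum.inl (ρ w), Sum.inr (φ (c :: w)), Sum.inl (ρ z'), Sum.inr (φ (c :: w))]) ?_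
    (length_bound_aux (Z := Z) P.support Q.support _ (by rw [Walk.length_support]; omega)
      (by rw [Walk.length_support]; omega) (by simp) hr)
  · intro x hx
    simp only [hC, Subgraph.verts_sup, Set.mem_union, Walk.verts_toSubgraph, Set.mem_setOf_eq,
      subgraphOfAdj_verts, Set.mem_insert_iff, Set.mem_singleton_iff] at hx
    rcases hx with (((hx | hx) | hx) | rfl | rfl) | rfl | rfl
    · exact two_le_ncard_of_cycle hG hZ hZC hx
    · exact two_le_of_mem_treePath hG hZ hZC hIR hw hP hPe hPC hendw hx
    · exact two_le_of_mem_treePath hG hZ hZC hIR hz' hQ hQe hQC hendz hx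
    · exact two_le_of_mem_treePath hG hZ hZC hIR hw hP hPe hPC hendw P.end_mem_support
    · exact two_le_ncard_neighborSet hG hCwy.symm hCzy.symm hρ
    · exact two_le_of_mem_treePath hG hZ hZC hIR hz' hQ hQe hQC hendz Q.end_mem_support
    · exact two_le_ncard_neighborSet hG hCwy.symm hCzy.symm hρ
  · intro x hx
    simp only [hC, Subgraph.verts_sup, Set.mem_union, Walk.verts_toSubgraph, Set.mem_setOf_eq,
      subgraphOfAdj_verts, Set.mem_insert_iff, Set.mem_singleton_iff] at hx
    simp only [List.mem_append, List.mem_cons, List.not_mem_nil, or_false]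
    rcases hx with ((((hx | hx) | hx) | hx | hx) | hx | hx) <;> simp only [hx, true_or, or_true]

/-- **Two new entry points coincide** (`φ (c :: w) = φ (c' :: w')`, `w ≠ w'` of length `≤ n`).
[folklore] -/
theorem collision_point_new {n : ℕ} (hr : ((Z.length + 4 * n + 10 : ℕ) : ℝ) ≤ r)
    (hIR : ∀ u u' : List Bool, u.length ≤ n → u'.length ≤ n → ρ u = ρ u' → u = u')
    {w w' : List Bool} (hw : w.length ≤ n) (hw' : w'.length ≤ n) (hww : w ≠ w') (c c' : Bool)
    (heq : φ (c :: w) = φ (c' :: w')) : False := by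
  obtain ⟨P, hP, -, hPe, hPl⟩ := exists_treePath hG H1 H2 (ρ := ρ) (φ := φ) w
  have hne5 : ∀ (c₀ : Bool) {u : List Bool}, u ≠ [] → φ (c₀ :: u) ≠ φ u := fun c₀ u hu => by
    obtain ⟨c', u', rfl⟩ := List.exists_cons_of_ne_nil hu
    exact H5 c₀ c' u'
  obtain ⟨Q, hQ, -, hQe, hQl⟩ := exists_treePath hG H1 H2 (ρ := ρ) (φ := φ) w'
  have hwy := adj_parent hG H1 H2 c w
  have hw'y : G.Adj (Sum.inl (ρ w')) (Sum.inr (φ (c :: w))) := by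
    rw [heq]; exact adj_parent hG H1 H2 c' w'
  set C := Z.toSubgraph ⊔ P.toSubgraph ⊔ Q.toSubgraph ⊔ G.subgraphOfAdj hwy ⊔
    G.subgraphOfAdj hw'y with hC
  have hZC : Z.toSubgraph ≤ C := le_sup_left.trans (le_sup_left.trans (le_sup_left.trans le_sup_left))
  have hPC : P.toSubgraph ≤ C := le_sup_right.trans (le_sup_left.trans (le_sup_left.trans le_sup_left))
  have hQC : Q.toSubgraph ≤ C := le_sup_right.trans (le_sup_left.trans le_sup_left)
  have hCwy : C.Adj (Sum.inl (ρ w)) (Sum.inr (φ (c :: w))) :=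
    (le_sup_right.trans le_sup_left : G.subgraphOfAdj hwy ≤ C).2 (subgraphOfAdj_adj_self hwy)
  have hCw'y : C.Adj (Sum.inl (ρ w')) (Sum.inr (φ (c :: w))) :=
    (le_sup_right : G.subgraphOfAdj hw'y ≤ C).2 (subgraphOfAdj_adj_self hw'y)
  have hendw : w ≠ [] → ∃ t, C.Adj (Sum.inl (ρ w)) t ∧ t ≠ Sum.inr (φ w) :=
    fun hwne => ⟨_, hCwy, fun h => hne5 c hwne (Sum.inr_injective h)⟩
  have hendw' : w' ≠ [] → ∃ t, C.Adj (Sum.inl (ρ w')) t ∧ t ≠ Sum.inr (φ w') :=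
    fun hwne => ⟨_, hCw'y, fun h =>
      hne5 c' hwne (heq.symm.trans (Sum.inr_injective h))⟩
  have hρ : (Sum.inl (ρ w) : ι ⊕ ℕ) ≠ Sum.inl (ρ w') := fun h =>
    hww (hIR _ _ hw hw' (Sum.inl_injective h))
  have h3 : 3 ≤ (C.neighborSet (Sum.inl (ρ []))).ncard := by
    rcases eq_or_ne w [] with rfl | hwne
    · have hw'ne : w' ≠ [] := fun h => hww h.symm
      exact three_le_of_treePath hG hZ H6 hZC hIR hw' hw'ne hQe hQC
    · exact three_le_of_treePath hG hZ H6 hZC hIR hw hwne hPe hPC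
  refine config_contra hG hS8 hexp C ?_ (b := ρ []) h3
    (L := Z.support ++ P.support ++ Q.support ++
      [Sum.inl (ρ w), Sum.inr (φ (c :: w)), Sum.inl (ρ w'), Sum.inr (φ (c :: w))]) ?_
    (length_bound_aux (Z := Z) P.support Q.support _ (by rw [Walk.length_support]; omega)
      (by rw [Walk.length_support]; omega) (by simp) hr)
  · intro x hx
    simp only [hC, Subgraph.verts_sup, Set.mem_union, Walk.verts_toSubgraph, Set.mem_setOf_eq,
      subgraphOfAdj_verts, Set.mem_insert_iff, Set.mem_singleton_iff] at hx
    rcases hx with (((hx | hx) | hx) | rfl | rfl) | rfl | rfl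
    · exact two_le_ncard_of_cycle hG hZ hZC hx
    · exact two_le_of_mem_treePath hG hZ hZC hIR hw hP hPe hPC hendw hx
    · exact two_le_of_mem_treePath hG hZ hZC hIR hw' hQ hQe hQC hendw' hx
    · exact two_le_of_mem_treePath hG hZ hZC hIR hw hP hPe hPC hendw P.end_mem_support
    · exact two_le_ncard_neighborSet hG hCwy.symm hCw'y.symm hρ
    · exact two_le_of_mem_treePath hG hZ hZC hIR hw' hQ hQe hQC hendw' Q.end_mem_support
    · exact two_le_ncard_neighborSet hG hCwy.symm hCw'y.symm hρ
  · intro x hx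
    simp only [hC, Subgraph.verts_sup, Set.mem_union, Walk.verts_toSubgraph, Set.mem_setOf_eq,
      subgraphOfAdj_verts, Set.mem_insert_iff, Set.mem_singleton_iff] at hx
    simp only [List.mem_append, List.mem_cons, List.not_mem_nil, or_false]
    rcases hx with ((((hx | hx) | hx) | hx | hx) | hx | hx) <;> simp only [hx, true_or, or_true]

end PhaseTwo

end MooreBound

end Summit.PneNP.PneNP.Theorems
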